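import Summits.Ventures.HSemireg.WedgeHankelRecurrenceAffinePolar

/-!
# Venture HSemireg — LEVELS: reading one more coefficient never lowers the middle rank and raises it by at most one, **`R^N(q) ≤ R^{N+1}(q) ≤ R^N(q) + 1` for EVERY class** (no window); the
# transition rule of N40 at the edge of the window (`2d ≤ N + 1`, the top rank of an odd level included): **continue the recurrence ⇒ `R^{N+1} = d`, break it ⇒ `R^{N+1} = d + 1`**; and the
# top rank of an even level: **a class with `R^{2t}(q) = t + 1` keeps `R^{2t+1}(q) = t + 1` whatever the next coefficient is, with a minimal recurrence of FULL degree `t + 1`** — the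
# three facts an `F_s`-census by middle rank needs at every level

HONEST FRAMING. Part of the Lean index of the computation cell `pub-hsemireg` (seat p10 gen 27, Sunday typer «UNIFORM-IN-n»).
LINEAR ALGEBRA OF HANKEL (catalecticant) MATRICES and of polynomials over a field ONLY: no variety, no cohomology theory, no sheaf, no Ext group and no semiregularity map is constructed
here; nothing here says that HC / HC_CM / HC_AV holds; no Literature fact is declared or used.  Custodian versions as in `WedgeHankelSiegelIdeal` (1/3); the dictionary (`R^N(q) = rank
H^N_{⌊N/2⌋}(q)`; «generic class» = top middle rank `⌊N/2⌋ + 1` at an even level) is QUOTED, never asserted.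

WHAT IS KEYED / IN THE TREE.  N34 (`WedgeHankelRecurrenceAffinePolar`, № 267): `rank_half_eq_and_mem_recSpace_iff_exists_affine`; N32 (№ 263) `dualSeq`, `mem_recSpace_dualSeq`; N23 (№ 176)
`eq_of_monic_recurrence`, `hkFun_eq_zero_of_mem_recSpace`; N29 (№ 237) `mem_recSpace_succ_succ_iff`; N18 (№ 173): `recSpace`, `mem_recSpace_iff`, `finrank_recSpace_self`, `recSpace_eq_bot_of_lt`,
`finiteDimensional_recSpace`, `natDegree_le_of_mem_recSpace`, `mem_degreeLT_succ_iff`; N15 `rank_hankel1_eq_min`; N13 (`WedgeHankelRankProfile`) `rank_le_rank_submatrix_add_one`.  Mathlib: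
`Matrix.rank_eq_finrank_span_cols`, `Matrix.rank_le_height`, `Fin.castLE`, `Polynomial.monic_mul_leadingCoeff_inv`.  (N40 `WedgeHankelRecurrenceExtension` has the transitions with the window
`2d ≤ N`; here the edge `2d = N + 1` is included by a different argument for the broken case.)
THIS FILE (namespace `Summit.Ventures.HSemireg.Wedge.HankelOuter` continued; CHAINED on N34; 0 definitions):
* §535 `rank_submatrix_cols_le`, `hankel1_eq_submatrix_level_succ` (`H^N_k(q)` = the first `N + 1 − k` columns of `H^{N+1}_k(q)`), `rank_hankel1_le_level_succ`, `rank_hankel1_level_succ_le_add_one`.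
* §536 **`rank_half_le_level_succ`** (`R^N(q) ≤ R^{N+1}(q)`), **`rank_half_level_succ_le_add_one`** (`R^{N+1}(q) ≤ R^N(q) + 1`) — every class, every field, no window.
* §537 EDGE TRANSITIONS (`R^N(q) = d`, `0 ≠ m ∈ Rec^N_d(q)`, `2d ≤ N + 1`): **`rank_half_level_succ_of_mem`** (`deg m = d`, `m ∈ Rec^{N+1}_d(q) ⇒ R^{N+1}(q) = d`), **`rank_half_level_succ_of_not_mem`**
  (`m ∉ Rec^{N+1}_d(q) ⇒ R^{N+1}(q) = d + 1`, any `m ∈ Rec^N_d(q)`: two minimal-recurrence lines, one inside the other, would coincide), `rank_half_level_succ_dichotomy`.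
* §538 THE GENERIC CLASSES OF AN EVEN LEVEL: **`rank_half_level_succ_of_top`** (`R^{2t}(q) = t + 1 ⇒ R^{2t+1}(q) = t + 1`), **`natDegree_eq_of_mem_recSpace_top`** (then every non-zero
  `m ∈ Rec^{2t+1}_{t+1}(q)` has degree `t + 1`: no node at infinity is created).
READING: with N39 (truncation) and N40 (extension) this completes the level-to-level transition table used by the census plan of the sheet (OPEN (α)): over `F_s`, from a class of rank `d`
at level `N` exactly `1` extension keeps the rank if the class is affine (`s − 1` raise it), `0` if it is polar (all `s` raise it), and the generic classes of an even level raise nothing.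
Nothing Ext-side.  New names only.
-/

open Module Polynomial
open scoped Matrix Polynomial

namespace Summit.Ventures.HSemireg.Wedge.HankelOuter

open Summit.Ventures.HSemireg.Wedge Summit.Ventures.HSemireg.Wedge.Hankel

variable (K : Type*) [Field K] {N : ℕ}

/-! ## §535. `H^N_k(q)` is `H^{N+1}_k(q)` with its last column removed -/

/-- keeping a subset of the columns does not raise the rank. -/
theorem rank_submatrix_cols_le {m n n₀ : Type} [Fintype m] [Fintype n] [Fintype n₀] (A : Matrix m n K) (f : n₀ → n) : (A.submatrix id f).rank ≤ A.rank := by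
  rw [Matrix.rank_eq_finrank_span_cols, Matrix.rank_eq_finrank_span_cols]
  refine Submodule.finrank_mono (Submodule.span_mono ?_)
  rintro _ ⟨i, rfl⟩
  refine ⟨f i, ?_⟩
  funext a
  rw [Matrix.col_apply, Matrix.col_apply, Matrix.submatrix_apply, id]

omit [Field K] in
/-- **`H^N_k(q)` is the submatrix of `H^{N+1}_k(q)` on the first `N + 1 − k` columns.** -/
theorem hankel1_eq_submatrix_level_succ (k : ℕ) (q : ℕ → K) :
    hankel1 K N k q = (hankel1 K (N + 1) k q).submatrix id (Fin.castLE (by omega : N + 1 - k ≤ N + 1 + 1 - k)) := by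
  ext i s
  simp only [hankel1, Matrix.submatrix_apply, Matrix.of_apply, id, Fin.val_castLE]

/-- `rank H^N_k(q) ≤ rank H^{N+1}_k(q)`. -/
theorem rank_hankel1_le_level_succ (k : ℕ) (q : ℕ → K) : (hankel1 K N k q).rank ≤ (hankel1 K (N + 1) k q).rank := by
  rw [hankel1_eq_submatrix_level_succ K (N := N) k q]
  exact rank_submatrix_cols_le K _ _

/-- `rank H^{N+1}_k(q) ≤ rank H^N_k(q) + 1` (one column more). -/
theorem rank_hankel1_level_succ_le_add_one (k : ℕ) (q : ℕ → K) : (hankel1 K (N + 1) k q).rank ≤ (hankel1 K N k q).rank + 1 := by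
  rcases Nat.lt_or_ge (N + 1) k with hk | hk
  · have e : (hankel1 K (N + 1) k q).rank = 0 := Nat.eq_zero_of_le_zero ((Matrix.rank_le_width _).trans (by omega))
    rw [e]; exact Nat.zero_le _
  · rw [hankel1_eq_submatrix_level_succ K (N := N) k q]
    refine rank_le_rank_submatrix_add_one K _ _ ⟨N + 1 - k, by omega⟩ fun j hj => ⟨⟨j, ?_⟩, Fin.ext rfl⟩
    have h1 := j.2
    have h2 : (j : ℕ) ≠ N + 1 - k := fun h => hj (Fin.ext h)
    omega

/-! ## §536. The middle rank is monotone in the level and `1`-Lipschitz — for every class -/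

/-- **`R^N(q) ≤ R^{N+1}(q)`** (every class, no window). -/
theorem rank_half_le_level_succ (q : ℕ → K) : (hankel1 K N (N / 2) q).rank ≤ (hankel1 K (N + 1) ((N + 1) / 2) q).rank := by
  rcases Nat.even_or_odd N with ⟨t, rfl⟩ | ⟨t, rfl⟩
  · rw [show (t + t) / 2 = t by omega, show (t + t + 1) / 2 = t by omega]
    exact rank_hankel1_le_level_succ K t q
  · rw [show (2 * t + 1) / 2 = t by omega, show (2 * t + 1 + 1) / 2 = t + 1 by omega]
    -- `rank H^N_t = rank H^N_{t+1}` (trapezoid law at the two middle degrees of an odd level), then one column more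
    have hA := rank_hankel1_eq_min K (show t ≤ 2 * t + 1 by omega) q
    have hB := rank_hankel1_eq_min K (show t + 1 ≤ 2 * t + 1 by omega) q
    rw [show (2 * t + 1) / 2 = t by omega] at hA hB
    have hR : (hankel1 K (2 * t + 1) t q).rank ≤ t + 1 := Matrix.rank_le_height _
    have h := rank_hankel1_le_level_succ K (N := 2 * t + 1) (t + 1) q
    omega

/-- **`R^{N+1}(q) ≤ R^N(q) + 1`** (every class, no window). -/
theorem rank_half_level_succ_le_add_one (q : ℕ → K) : (hankel1 K (N + 1) ((N + 1) / 2) q).rank ≤ (hankel1 K N (N / 2) q).rank + 1 := by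
  rcases Nat.even_or_odd N with ⟨t, rfl⟩ | ⟨t, rfl⟩
  · rw [show (t + t) / 2 = t by omega, show (t + t + 1) / 2 = t by omega]
    exact rank_hankel1_level_succ_le_add_one K t q
  · rw [show (2 * t + 1) / 2 = t by omega, show (2 * t + 1 + 1) / 2 = t + 1 by omega]
    have hA := rank_hankel1_eq_min K (show t ≤ 2 * t + 1 by omega) q
    have hB := rank_hankel1_eq_min K (show t + 1 ≤ 2 * t + 1 by omega) q
    rw [show (2 * t + 1) / 2 = t by omega] at hA hB
    have hR : (hankel1 K (2 * t + 1) t q).rank ≤ t + 1 := Matrix.rank_le_height _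
    have h := rank_hankel1_level_succ_le_add_one K (N := 2 * t + 1) (t + 1) q
    omega

/-! ## §537. The transition at the edge of the window (`2d ≤ N + 1`) -/

/-- **CONTINUE ⇒ SAME RANK: `R^N(q) = d`, `0 ≠ m ∈ Rec^N_d(q)` of full degree `d`, `2d ≤ N + 1`, `m ∈ Rec^{N+1}_d(q) ⇒ R^{N+1}(q) = d`** (N34's structure theorem at the two levels and N23's
unique continuation; N40 had `2d ≤ N`). -/
theorem rank_half_level_succ_of_mem {d : ℕ} {q : ℕ → K} {m : K[X]} (hq : (hankel1 K N (N / 2) q).rank = d) (hm : m ∈ recSpace K N q d) (hm0 : m ≠ 0) (hmd : m.natDegree = d)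
    (h2 : d + d ≤ N + 1) (hmem : m ∈ recSpace K (N + 1) q d) : (hankel1 K (N + 1) ((N + 1) / 2) q).rank = d := by
  -- normalise `m`
  set m₁ := m * Polynomial.C (m.leadingCoeff)⁻¹ with hm₁def
  have hmo : m₁.Monic := Polynomial.monic_mul_leadingCoeff_inv hm0
  have hdeg : m₁.natDegree = d := by rw [hm₁def, Polynomial.natDegree_mul_leadingCoeff_inv m hm0, hmd]
  have hsm : ∀ M j, m ∈ recSpace K M q j → m₁ ∈ recSpace K M q j := fun M j h => by
    rw [hm₁def, mul_comm, Polynomial.C_mul']; exact Submodule.smul_mem _ _ h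
  obtain ⟨a, hcop, ha, h⟩ := (rank_half_eq_and_mem_recSpace_iff_exists_affine K (N := N) hmo (by rw [hdeg]; omega) q).mp
    ⟨by rw [hdeg]; exact hq, by rw [hdeg]; exact hsm N d hm⟩
  have hm₁' : m₁ ∈ recSpace K (N + 1) q m₁.natDegree := by rw [hdeg]; exact hsm (N + 1) d hmem
  have hagree : ∀ j ≤ N + 1, q j = dualSeq K m₁ a j :=
    eq_of_monic_recurrence K hmo rfl (hkFun_eq_zero_of_mem_recSpace K hm₁') (hkFun_eq_zero_of_mem_recSpace K (mem_recSpace_dualSeq K (N := N + 1) hmo a))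
      fun j hj => h j (by omega)
  have key := (rank_half_eq_and_mem_recSpace_iff_exists_affine K (N := N + 1) hmo (by rw [hdeg]; omega) q).mpr ⟨a, hcop, ha, hagree⟩
  rw [hdeg] at key
  exact key.1

/-- **BREAK ⇒ RANK UP: `R^N(q) = d`, `m ∈ Rec^N_d(q)`, `2d ≤ N + 1`, `m ∉ Rec^{N+1}_d(q) ⇒ R^{N+1}(q) = d + 1`** — by §536 `R^{N+1} ∈ {d, d + 1}`, and `R^{N+1} = d` would make `Rec^{N+1}_d(q)`
a line inside the line `Rec^N_d(q) = K · m`, hence equal to it, hence containing `m`. (No hypothesis on `deg m`.) -/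
theorem rank_half_level_succ_of_not_mem {d : ℕ} {q : ℕ → K} {m : K[X]} (hq : (hankel1 K N (N / 2) q).rank = d) (hm : m ∈ recSpace K N q d)
    (h2 : d + d ≤ N + 1) (hmem : m ∉ recSpace K (N + 1) q d) : (hankel1 K (N + 1) ((N + 1) / 2) q).rank = d + 1 := by
  have hlo := rank_half_le_level_succ K (N := N) q
  have hhi := rank_half_level_succ_le_add_one K (N := N) q
  rw [hq] at hlo hhi
  rcases (Nat.le_succ_iff.mp hhi) with hle | heq
  · -- `R^{N+1} ≤ d`, hence `= d`: the two minimal-recurrence lines coincide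
    exfalso
    have hd : (hankel1 K (N + 1) ((N + 1) / 2) q).rank = d := le_antisymm hle hlo
    haveI := finiteDimensional_recSpace K (N := N) q d
    haveI := finiteDimensional_recSpace K (N := N + 1) q d
    have h1 : finrank K (recSpace K (N + 1) q d) = 1 := finrank_recSpace_self K hd (by omega)
    have h1' : finrank K (recSpace K N q d) = 1 := finrank_recSpace_self K hq h2
    have hsub : recSpace K (N + 1) q d ≤ recSpace K N q d := fun p hp => by
      rw [mem_recSpace_iff] at hp ⊢; exact ⟨hp.1, fun s hs => hp.2 s (by omega)⟩
    have heq : recSpace K (N + 1) q d = recSpace K N q d := Submodule.eq_of_le_of_finrank_eq hsub (by rw [h1, h1'])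
    exact hmem (by rw [heq]; exact hm)
  · exact heq

/-- the dichotomy at the edge: **`R^{N+1}(q) = d` with `m` kept, or `R^{N+1}(q) = d + 1` with `m` broken** (full-degree `m`, `2d ≤ N + 1`). -/
theorem rank_half_level_succ_dichotomy {d : ℕ} {q : ℕ → K} {m : K[X]} (hq : (hankel1 K N (N / 2) q).rank = d) (hm : m ∈ recSpace K N q d) (hm0 : m ≠ 0) (hmd : m.natDegree = d)
    (h2 : d + d ≤ N + 1) :
    (m ∈ recSpace K (N + 1) q d ∧ (hankel1 K (N + 1) ((N + 1) / 2) q).rank = d) ∨ (m ∉ recSpace K (N + 1) q d ∧ (hankel1 K (N + 1) ((N + 1) / 2) q).rank = d + 1) := by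
  by_cases hmem : m ∈ recSpace K (N + 1) q d
  · exact Or.inl ⟨hmem, rank_half_level_succ_of_mem K hq hm hm0 hmd h2 hmem⟩
  · exact Or.inr ⟨hmem, rank_half_level_succ_of_not_mem K hq hm h2 hmem⟩

/-! ## §538. The generic classes of an even level: nothing is created by the next coefficient -/

/-- **THE TOP RANK OF AN EVEN LEVEL PERSISTS: `R^{2t}(q) = t + 1 ⇒ R^{2t+1}(q) = t + 1`** (the rank cannot drop with the level and `t + 1` is also the maximum at level `2t + 1`). -/
theorem rank_half_level_succ_of_top {t : ℕ} {q : ℕ → K} (hq : (hankel1 K (2 * t) (2 * t / 2) q).rank = t + 1) :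
    (hankel1 K (2 * t + 1) ((2 * t + 1) / 2) q).rank = t + 1 := by
  have hlo := rank_half_le_level_succ K (N := 2 * t) q
  rw [hq] at hlo
  have hhi : (hankel1 K (2 * t + 1) ((2 * t + 1) / 2) q).rank ≤ (2 * t + 1) / 2 + 1 := Matrix.rank_le_height _
  rw [show (2 * t + 1) / 2 = t by omega] at hhi ⊢
  rw [show (2 * t + 1) / 2 = t by omega] at hlo
  omega

/-- **… and such a class has NO node at infinity at level `2t + 1`: every non-zero `m ∈ Rec^{2t+1}_{t+1}(q)` has full degree `t + 1`** (a recurrence of degree `≤ t` would already be one at level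
`2t`, forcing `R^{2t}(q) ≤ t`). -/
theorem natDegree_eq_of_mem_recSpace_top {t : ℕ} {q : ℕ → K} (hq : (hankel1 K (2 * t) (2 * t / 2) q).rank = t + 1) {m : K[X]}
    (hm : m ∈ recSpace K (2 * t + 1) q (t + 1)) (hm0 : m ≠ 0) : m.natDegree = t + 1 := by
  have hle : m.natDegree ≤ t + 1 := natDegree_le_of_mem_recSpace K hm
  by_contra hne
  have hmt : m ∈ Polynomial.degreeLT K (t + 1) := (mem_degreeLT_succ_iff K).mpr (by omega)
  have hm' : m ∈ recSpace K (2 * t) q t := (mem_recSpace_succ_succ_iff K hmt).mp hm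
  have h0 := recSpace_eq_bot_of_lt K hq (show t < t + 1 by omega)
  rw [h0, Submodule.mem_bot] at hm'
  exact hm0 hm'

end Summit.Ventures.HSemireg.Wedge.HankelOuter
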